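import Summits.AnomalousDissipation.AnomalousDissipation.Theorems.SoloBlindSteadyWork
import Literature.Analysis.FunctionSpaces.TorusLerayHelmholtz
import Literature.Analysis.FunctionSpaces.TorusLinearisedFormTruncation
import Literature.Analysis.FunctionSpaces.TorusClassicalNSUniqueness

/-!
# Anomalous dissipation of steady families = Reynolds-stress production against the limit
# (solo soloist, blind mode)

Setting: smooth steady states `(Uⱼ, Pⱼ)` of `NS_{νⱼ}(f)` on `T^d` with one FIXED smooth force `f`
(`Torus.IsSteadyNSState`), `νⱼ → 0`, and a smooth divergence-free comparison field `V` (think: the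
weak `L²` limit of the family, when it happens to be smooth). Write `wⱼ = Uⱼ − V` (the fluctuation).

* `steady_momentum`, `steady_work_identity` (any `d`): the pointwise steady equation and
  `ν‖∇U‖₂² = ∫⟪f, U⟫` (the `d = 3` copy is `dissipation_eq_work_classical`).
* `work_on_test_field`: `∫⟪f, V⟫ = ∫⟪(U·∇)U, V⟫ − ν ∫⟪U, ΔV⟫` (test the steady equation against `V`;
  the pressure drops out, Temam 1984 Ch. II §1).
* `convective_work_eq`: the exact algebra of the Reynolds decomposition `U = V + w` for smooth
  divergence-free `U`, `V`:  `∫⟪(U·∇)U, V⟫ = −∫⟪(V·∇)V, w⟫ − ∫⟪(w·∇)V, w⟫`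
  (antisymmetry of the trilinear form, Temam 1984 Ch. II Lemma 1.3; the last integral is
  `∫ w⊗w : ∇V`, minus the PRODUCTION term of the mean-kinetic-energy budget).
* `anomaly_eq_production`: if `∫⟪f, Uⱼ − V⟫ → 0` and `∫⟪(V·∇)V, Uⱼ − V⟫ → 0` (weak convergence
  `Uⱼ ⇀ V` tested on just these two fields) and `∫‖Uⱼ‖² ≤ E₀`, then BOTH
  `νⱼ‖∇Uⱼ‖₂² → ∫⟪f, V⟫` and `−∫⟪(wⱼ·∇)V, wⱼ⟫ → ∫⟪f, V⟫`: the limiting dissipation exists and equals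
  the limiting production of the fluctuations against the strain of the limit field.
* `abs_production_le`: `|∫⟪(w·∇)V, w⟫| ≤ M ∫‖w‖²` when `|∇V| ≤ M` pointwise (Frobenius norm).
* `dissipation_limit_le_strain_mul_defect`, `dissipation_floor_le_strain_mul_defect`: hence
  `lim νⱼ‖∇Uⱼ‖₂² = ∫⟪f, V⟫ ≤ M · D` whenever `∫‖Uⱼ − V‖² ≤ D` for all `j`; a dissipation floor
  `ε ≤ νⱼ‖∇Uⱼ‖₂²` forces `ε ≤ M · D`: a steady zeroth-law family stays at `L²`-distance
  `≥ (ε/M)^{1/2}` from every smooth divergence-free field with `|∇V| ≤ M` that it approaches weakly —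
  the anomaly needs BOTH an energy defect (no strong convergence; cf. the steady Onsager picture) AND
  a strained limit (production requires mean shear).
[cite: Temam1984, Ch. II §1.2 Lemma 1.3] [cite: DoeringFoias2002, §2 (2.4) and §3] [folklore]
-/

open MeasureTheory Filter Topology Set
open scoped ENNReal NNReal InnerProductSpace

noncomputable section

namespace Summit.AnomalousDissipation.AnomalousDissipation.Theorems

open Literature.Analysis.FunctionSpaces Literature.Analysis.FluidPDE

variable {d : Type*} [Fintype d] [DecidableEq d]

omit [DecidableEq d] in
/-- Continuous real functions on the compact torus are integrable. [folklore] -/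
private theorem integrable_of_continuous_torus {g : UnitAddTorus d → ℝ} (hg : Continuous g) :
    Integrable g volume :=
  hg.integrable_of_hasCompactSupport (HasCompactSupport.of_compactSpace g)

/-- **The steady momentum equation, pointwise**: `(U·∇)U = νΔU − ∇P + f` for a steady state
(the time derivative of the constant-in-time solution vanishes). [folklore] -/
theorem steady_momentum {ν : ℝ} {f U : UnitAddTorus d → EuclideanSpace ℝ d} {P : UnitAddTorus d → ℝ}
    (h : Torus.IsSteadyNSState ν f U P) (x : UnitAddTorus d) :
    Torus.convect U U x = ν • Torus.laplacian U x - Torus.gradient P x + f x := by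
  have hm := h.momentum 0 (mem_univ _) x
  have h0 : Torus.timeDerivWithin univ (fun _ : ℝ => U) 0 x = 0 := by
    simp [Torus.timeDerivWithin]
  simpa [h0] using hm

/-- **Steady energy identity in any dimension**: `ν ‖∇U‖₂² = ∫ ⟪f, U⟫` (Temam 1979 Ch. II (1.25);
same proof as the `d = 3` copy `dissipation_eq_work_classical`). [cite: Temam1979, Ch. II (1.25)] -/
theorem steady_work_identity {ν : ℝ} {f U : UnitAddTorus d → EuclideanSpace ℝ d} {P : UnitAddTorus d → ℝ}
    (h : Torus.IsSteadyNSState ν f U P) :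
    ν * Torus.gradNormSq U = ∫ x, ⟪f x, U x⟫_ℝ := by
  have hb := Torus.IsClassicalNSSolutionOn.energy_balance_holds h convex_univ (mem_univ (0 : ℝ))
  have hc : HasDerivWithinAt (fun _ : ℝ => Torus.kineticEnergy U) 0 (univ : Set ℝ) 0 :=
    (hasDerivAt_const (0 : ℝ) (Torus.kineticEnergy U)).hasDerivWithinAt
  have huniq : -ν * Torus.gradNormSq U + ∫ x, ⟪f x, U x⟫_ℝ = 0 :=
    (hasDerivWithinAt_univ.1 hb).unique (hasDerivWithinAt_univ.1 hc)
  linarith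

/-- **Work of the force on a test field**: for a steady state and a smooth divergence-free `V`,
`∫⟪f, V⟫ = ∫⟪(U·∇)U, V⟫ − ν ∫⟪U, ΔV⟫` (pair the steady equation with `V`; `∫⟪∇P, V⟫ = 0` and
`∫⟪ΔU, V⟫ = ∫⟪U, ΔV⟫`). [cite: Temam1984, Ch. II §1.2 Lemma 1.3] -/
theorem work_on_test_field {ν : ℝ} {f U V : UnitAddTorus d → EuclideanSpace ℝ d}
    {P : UnitAddTorus d → ℝ} (h : Torus.IsSteadyNSState ν f U P)
    (hV : Torus.IsSmooth V) (hVd : Torus.IsDivFree V) :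
    ∫ x, ⟪f x, V x⟫_ℝ =
      (∫ x, ⟪Torus.convect U U x, V x⟫_ℝ) - ν * ∫ x, ⟪U x, Torus.laplacian V x⟫_ℝ := by
  have hU : Torus.IsSmooth U :=
    (Torus.IsClassicalNSSolutionOn.smooth_velocity h).isSmooth_slice (mem_univ (0 : ℝ))
  have hP : Torus.IsSmooth P :=
    (Torus.IsClassicalNSSolutionOn.smooth_pressure h).isSmooth_slice (mem_univ (0 : ℝ))
  have hpt : ∀ x, ⟪f x, V x⟫_ℝ =
      (⟪Torus.convect U U x, V x⟫_ℝ - ν * ⟪Torus.laplacian U x, V x⟫_ℝ)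
        + ⟪Torus.gradient P x, V x⟫_ℝ := by
    intro x
    have hfx : f x = Torus.convect U U x - ν • Torus.laplacian U x + Torus.gradient P x := by
      rw [steady_momentum h x]; abel
    rw [hfx, inner_add_left, inner_sub_left, real_inner_smul_left]
  have i1 : Integrable (fun x => ⟪Torus.convect U U x, V x⟫_ℝ) volume :=
    integrable_of_continuous_torus ((hU.convect hU).continuous.inner hV.continuous)
  have i2 : Integrable (fun x => ν * ⟪Torus.laplacian U x, V x⟫_ℝ) volume :=
    (integrable_of_continuous_torus (hU.laplacian.continuous.inner hV.continuous)).const_mul ν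
  have i3 : Integrable (fun x => ⟪Torus.gradient P x, V x⟫_ℝ) volume :=
    integrable_of_continuous_torus (hP.gradient.continuous.inner hV.continuous)
  have i12 : Integrable (fun x => ⟪Torus.convect U U x, V x⟫_ℝ - ν * ⟪Torus.laplacian U x, V x⟫_ℝ)
      volume := i1.sub i2
  simp_rw [hpt]
  rw [integral_add i12 i3, integral_sub i1 i2, integral_const_mul,
    Torus.integral_inner_gradient_eq_zero_of_isDivFree hV hP hVd, add_zero,
    Torus.integral_inner_laplacian_comm hU hV]

/-- **Reynolds decomposition of the convective work** (exact, smooth divergence-free `U`, `V`,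
`w = U − V`): `∫⟪(U·∇)U, V⟫ = −∫⟪(V·∇)V, w⟫ − ∫⟪(w·∇)V, w⟫`. The terms `∫⟪(V·∇)V, V⟫` and
`∫⟪(w·∇)V, V⟫` vanish by antisymmetry of the trilinear form (Temam 1984, Ch. II Lemma 1.3); the
survivor `∫⟪(w·∇)V, w⟫ = ∫ w⊗w : ∇V` is minus the production term. [cite: Temam1984, Ch. II §1.2 Lemma 1.3] -/
theorem convective_work_eq {U V : UnitAddTorus d → EuclideanSpace ℝ d}
    (hU : Torus.IsSmooth U) (hUd : Torus.IsDivFree U) (hV : Torus.IsSmooth V)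
    (hVd : Torus.IsDivFree V) :
    ∫ x, ⟪Torus.convect U U x, V x⟫_ℝ =
      -(∫ x, ⟪Torus.convect V V x, U x - V x⟫_ℝ)
        - ∫ x, ⟪Torus.convect (U - V) V x, U x - V x⟫_ℝ := by
  have hW : Torus.IsSmooth (U - V) := hU.sub hV
  have hWd : Torus.IsDivFree (U - V) := fun x => by
    rw [Torus.divergence_sub (hU.isContDiff (by simp)) (hV.isContDiff (by simp)), hUd x, hVd x,
      sub_zero]
  rw [Torus.integral_inner_convect_eq_neg hU hUd hU hV]
  have hsplit : ∀ x, ⟪U x, Torus.convect U V x⟫_ℝ =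
      (⟪Torus.convect V V x, V x⟫_ℝ + ⟪Torus.convect (U - V) V x, V x⟫_ℝ)
        + (⟪Torus.convect V V x, U x - V x⟫_ℝ + ⟪Torus.convect (U - V) V x, U x - V x⟫_ℝ) := by
    intro x
    have hc : Torus.convect U V x = Torus.convect V V x + Torus.convect (U - V) V x := by
      simp only [Torus.convect, Pi.sub_apply, map_sub]; abel
    have key : ∀ A : EuclideanSpace ℝ d, ⟪U x, A⟫_ℝ = ⟪A, V x⟫_ℝ + ⟪A, U x - V x⟫_ℝ := by
      intro A
      rw [← inner_add_right, real_inner_comm]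
      congr 1; abel
    rw [hc, key, inner_add_left, inner_add_left]
  have cVV : Continuous (Torus.convect V V) := (hV.convect hV).continuous
  have cWV : Continuous (Torus.convect (U - V) V) := (hW.convect hV).continuous
  have cw : Continuous fun x => U x - V x := hU.continuous.sub hV.continuous
  have j1 : Integrable (fun x => ⟪Torus.convect V V x, V x⟫_ℝ) volume :=
    integrable_of_continuous_torus (cVV.inner hV.continuous)
  have j2 : Integrable (fun x => ⟪Torus.convect (U - V) V x, V x⟫_ℝ) volume :=
    integrable_of_continuous_torus (cWV.inner hV.continuous)
  have j3 : Integrable (fun x => ⟪Torus.convect V V x, U x - V x⟫_ℝ) volume :=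
    integrable_of_continuous_torus (cVV.inner cw)
  have j4 : Integrable (fun x => ⟪Torus.convect (U - V) V x, U x - V x⟫_ℝ) volume :=
    integrable_of_continuous_torus (cWV.inner cw)
  have j12 : Integrable (fun x => ⟪Torus.convect V V x, V x⟫_ℝ + ⟪Torus.convect (U - V) V x, V x⟫_ℝ)
      volume := j1.add j2
  have j34 : Integrable (fun x => ⟪Torus.convect V V x, U x - V x⟫_ℝ
      + ⟪Torus.convect (U - V) V x, U x - V x⟫_ℝ) volume := j3.add j4
  simp_rw [hsplit]
  rw [integral_add j12 j34, integral_add j1 j2, integral_add j3 j4,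
    Torus.integral_inner_convect_self_right_eq_zero hV hVd hV,
    Torus.integral_inner_convect_self_right_eq_zero hW hWd hV]
  ring

/-- **Anomalous dissipation = production against the limit.** Steady states `Uⱼ` of `NS_{νⱼ}(f)`
with `νⱼ → 0`, `∫‖Uⱼ‖² ≤ E₀`, converging weakly to a smooth divergence-free `V` in the minimal sense
`∫⟪f, Uⱼ − V⟫ → 0`, `∫⟪(V·∇)V, Uⱼ − V⟫ → 0`: then `νⱼ‖∇Uⱼ‖₂² → ∫⟪f, V⟫` and
`−∫⟪(wⱼ·∇)V, wⱼ⟫ → ∫⟪f, V⟫` (`wⱼ = Uⱼ − V`): the limiting dissipation is the limiting work of the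
fluctuation Reynolds stress against the strain of `V` (the production term of the Reynolds-averaged
energy budget, here for vanishing viscosity at fixed force). [folklore] -/
theorem anomaly_eq_production {ν : ℕ → ℝ} {f V : UnitAddTorus d → EuclideanSpace ℝ d}
    {U : ℕ → UnitAddTorus d → EuclideanSpace ℝ d} {P : ℕ → UnitAddTorus d → ℝ} {E₀ : ℝ}
    (h : ∀ j, Torus.IsSteadyNSState (ν j) f (U j) (P j)) (hf : Torus.IsSmooth f)
    (hV : Torus.IsSmooth V) (hVd : Torus.IsDivFree V) (hν₀ : Tendsto ν atTop (𝓝 0))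
    (hE : ∀ j, ∫ x, ‖U j x‖ ^ 2 ≤ E₀)
    (h1 : Tendsto (fun j => ∫ x, ⟪f x, U j x - V x⟫_ℝ) atTop (𝓝 0))
    (h2 : Tendsto (fun j => ∫ x, ⟪Torus.convect V V x, U j x - V x⟫_ℝ) atTop (𝓝 0)) :
    Tendsto (fun j => ν j * Torus.gradNormSq (U j)) atTop (𝓝 (∫ x, ⟪f x, V x⟫_ℝ)) ∧
      Tendsto (fun j => -∫ x, ⟪Torus.convect (U j - V) V x, U j x - V x⟫_ℝ) atTop
        (𝓝 (∫ x, ⟪f x, V x⟫_ℝ)) := by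
  have hU : ∀ j, Torus.IsSmooth (U j) := fun j =>
    (Torus.IsClassicalNSSolutionOn.smooth_velocity (h j)).isSmooth_slice (mem_univ (0 : ℝ))
  have hUd : ∀ j, Torus.IsDivFree (U j) := fun j =>
    Torus.IsClassicalNSSolutionOn.divFree (h j) 0 (mem_univ (0 : ℝ))
  -- `∫⟪f, Uⱼ − V⟫ = ∫⟪f, Uⱼ⟫ − ∫⟪f, V⟫`
  have hsub : ∀ j, ∫ x, ⟪f x, U j x - V x⟫_ℝ = (∫ x, ⟪f x, U j x⟫_ℝ) - ∫ x, ⟪f x, V x⟫_ℝ := by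
    intro j
    simp_rw [inner_sub_right]
    exact integral_sub (integrable_of_continuous_torus (hf.continuous.inner (hU j).continuous))
      (integrable_of_continuous_torus (hf.continuous.inner hV.continuous))
  refine ⟨?_, ?_⟩
  · have ht : Tendsto (fun j => (∫ x, ⟪f x, V x⟫_ℝ) + ∫ x, ⟪f x, U j x - V x⟫_ℝ) atTop
        (𝓝 ((∫ x, ⟪f x, V x⟫_ℝ) + 0)) := tendsto_const_nhds.add h1
    rw [add_zero] at ht
    refine ht.congr fun j => ?_
    rw [steady_work_identity (h j), hsub j]; ring
  · -- the viscous pairing `νⱼ ∫⟪Uⱼ, ΔV⟫ → 0`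
    have hE0 : 0 ≤ E₀ := (integral_nonneg fun x => sq_nonneg _).trans (hE 0)
    set C := Real.sqrt (E₀ * ∫ x, ‖Torus.laplacian V x‖ ^ 2) with hC_def
    have hLb : ∀ j, |∫ x, ⟪U j x, Torus.laplacian V x⟫_ℝ| ≤ C := by
      intro j
      have hUc := (hU j).continuous
      have hLc := hV.laplacian.continuous
      have hint : Integrable (fun x => ⟪U j x, Torus.laplacian V x⟫_ℝ) volume :=
        integrable_of_continuous_torus (hUc.inner hLc)
      have hE' : Integrable (fun x => ‖U j x‖ ^ 2) volume :=
        integrable_of_continuous_torus (hUc.norm.pow 2)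
      have hL' : Integrable (fun x => ‖Torus.laplacian V x‖ ^ 2) volume :=
        integrable_of_continuous_torus (hLc.norm.pow 2)
      have habs : |∫ x, ⟪U j x, Torus.laplacian V x⟫_ℝ| ≤ ∫ x, |⟪U j x, Torus.laplacian V x⟫_ℝ| :=
        abs_integral_le_integral_abs
      refine habs.trans ?_
      calc ∫ x, |⟪U j x, Torus.laplacian V x⟫_ℝ|
          ≤ Real.sqrt ((∫ x, ‖U j x‖ ^ 2) * ∫ x, ‖Torus.laplacian V x‖ ^ 2) := by
            refine integral_le_sqrt_integral_mul_integral (ae_of_all _ fun x => abs_nonneg _)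
              (ae_of_all _ fun x => sq_nonneg _) (ae_of_all _ fun x => sq_nonneg _)
              (ae_of_all _ fun x => ?_) (hUc.inner hLc).abs.aestronglyMeasurable hE' hL'
            rw [← mul_pow]
            exact pow_le_pow_left₀ (abs_nonneg _) (abs_real_inner_le_norm _ _) 2
        _ ≤ C := Real.sqrt_le_sqrt (mul_le_mul_of_nonneg_right (hE j)
            (integral_nonneg fun x => sq_nonneg _))
    have hνL : Tendsto (fun j => ν j * ∫ x, ⟪U j x, Torus.laplacian V x⟫_ℝ) atTop (𝓝 0) := by
      refine squeeze_zero_norm (fun j => ?_) (by simpa using hν₀.norm.mul_const C)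
      rw [norm_mul, Real.norm_eq_abs, Real.norm_eq_abs]
      exact mul_le_mul_of_nonneg_left (hLb j) (abs_nonneg _)
    have ht : Tendsto (fun j => (∫ x, ⟪f x, V x⟫_ℝ) + (∫ x, ⟪Torus.convect V V x, U j x - V x⟫_ℝ)
        + ν j * ∫ x, ⟪U j x, Torus.laplacian V x⟫_ℝ) atTop (𝓝 ((∫ x, ⟪f x, V x⟫_ℝ) + 0 + 0)) :=
      (tendsto_const_nhds.add h2).add hνL
    rw [add_zero, add_zero] at ht
    refine ht.congr fun j => ?_
    rw [work_on_test_field (h j) hV hVd, convective_work_eq (hU j) (hUd j) hV hVd]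
    ring

/-- **Production is bounded by strain × fluctuation energy**: if `(∑ᵢ ‖∂ᵢV(x)‖²)^{1/2} ≤ M`
on `T^d` then `|∫⟪(w·∇)V, w⟫| ≤ M ∫‖w‖²`. [folklore] -/
theorem abs_production_le {w V : UnitAddTorus d → EuclideanSpace ℝ d} (hw : Torus.IsSmooth w)
    (hV : Torus.IsSmooth V) {M : ℝ}
    (hM : ∀ x, Real.sqrt (∑ i, ‖Torus.partialDeriv i V x‖ ^ 2) ≤ M) :
    |∫ x, ⟪Torus.convect w V x, w x⟫_ℝ| ≤ M * ∫ x, ‖w x‖ ^ 2 := by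
  have hM0 : 0 ≤ M := (Real.sqrt_nonneg _).trans (hM 0)
  have hpt : ∀ x, |⟪Torus.convect w V x, w x⟫_ℝ| ≤ M * ‖w x‖ ^ 2 := by
    intro x
    have h1 := abs_real_inner_le_norm (Torus.convect w V x) (w x)
    have h2 := Torus.norm_convect_le_norm_mul_sqrt (hV.isContDiff (by simp)) w x
    calc |⟪Torus.convect w V x, w x⟫_ℝ| ≤ ‖Torus.convect w V x‖ * ‖w x‖ := h1
      _ ≤ ‖w x‖ * Real.sqrt (∑ i, ‖Torus.partialDeriv i V x‖ ^ 2) * ‖w x‖ :=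
          mul_le_mul_of_nonneg_right h2 (norm_nonneg _)
      _ ≤ ‖w x‖ * M * ‖w x‖ :=
          mul_le_mul_of_nonneg_right (mul_le_mul_of_nonneg_left (hM x) (norm_nonneg _))
            (norm_nonneg _)
      _ = M * ‖w x‖ ^ 2 := by ring
  have hwc := hw.continuous
  have hint : Integrable (fun x => |⟪Torus.convect w V x, w x⟫_ℝ|) volume :=
    (integrable_of_continuous_torus ((hw.convect hV).continuous.inner hwc)).abs
  have hint2 : Integrable (fun x => M * ‖w x‖ ^ 2) volume :=
    (integrable_of_continuous_torus (hwc.norm.pow 2)).const_mul M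
  calc |∫ x, ⟪Torus.convect w V x, w x⟫_ℝ| ≤ ∫ x, |⟪Torus.convect w V x, w x⟫_ℝ| :=
        abs_integral_le_integral_abs
    _ ≤ ∫ x, M * ‖w x‖ ^ 2 := integral_mono hint hint2 hpt
    _ = M * ∫ x, ‖w x‖ ^ 2 := integral_const_mul _ _

/-- **The limiting dissipation is at most strain × energy defect**: in the setting of
`anomaly_eq_production`, if `|∇V| ≤ M` and `∫‖Uⱼ − V‖² ≤ D` for all `j`, then
`lim νⱼ‖∇Uⱼ‖₂² = ∫⟪f, V⟫ ≤ M · D`. [folklore] -/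
theorem dissipation_limit_le_strain_mul_defect {ν : ℕ → ℝ} {f V : UnitAddTorus d → EuclideanSpace ℝ d}
    {U : ℕ → UnitAddTorus d → EuclideanSpace ℝ d} {P : ℕ → UnitAddTorus d → ℝ} {E₀ M D : ℝ}
    (h : ∀ j, Torus.IsSteadyNSState (ν j) f (U j) (P j)) (hf : Torus.IsSmooth f)
    (hV : Torus.IsSmooth V) (hVd : Torus.IsDivFree V) (hν₀ : Tendsto ν atTop (𝓝 0))
    (hE : ∀ j, ∫ x, ‖U j x‖ ^ 2 ≤ E₀)
    (h1 : Tendsto (fun j => ∫ x, ⟪f x, U j x - V x⟫_ℝ) atTop (𝓝 0))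
    (h2 : Tendsto (fun j => ∫ x, ⟪Torus.convect V V x, U j x - V x⟫_ℝ) atTop (𝓝 0))
    (hM : ∀ x, Real.sqrt (∑ i, ‖Torus.partialDeriv i V x‖ ^ 2) ≤ M)
    (hD : ∀ j, ∫ x, ‖U j x - V x‖ ^ 2 ≤ D) :
    ∫ x, ⟪f x, V x⟫_ℝ ≤ M * D := by
  have hU : ∀ j, Torus.IsSmooth (U j) := fun j =>
    (Torus.IsClassicalNSSolutionOn.smooth_velocity (h j)).isSmooth_slice (mem_univ (0 : ℝ))
  have hM0 : 0 ≤ M := (Real.sqrt_nonneg _).trans (hM 0)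
  obtain ⟨-, hprod⟩ := anomaly_eq_production h hf hV hVd hν₀ hE h1 h2
  refine le_of_tendsto' hprod fun j => ?_
  have hb := abs_production_le (w := U j - V) ((hU j).sub hV) hV hM
  have hle : -∫ x, ⟪Torus.convect (U j - V) V x, U j x - V x⟫_ℝ ≤ M * ∫ x, ‖(U j - V) x‖ ^ 2 :=
    (neg_le_abs _).trans hb
  exact hle.trans (mul_le_mul_of_nonneg_left (hD j) hM0)

/-- **A dissipation floor forces an energy defect against every smooth strained comparison field**:
if moreover `ε ≤ νⱼ‖∇Uⱼ‖₂²` for all `j`, then `ε ≤ M · D`. With `V` the (smooth) weak limit of a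
steady zeroth-law family this reads: energy defect `≥ ε / sup|∇V|` — no strong `L²` convergence to
any smooth field, and no anomaly if the limit is unstrained. [folklore] -/
theorem dissipation_floor_le_strain_mul_defect {ν : ℕ → ℝ} {f V : UnitAddTorus d → EuclideanSpace ℝ d}
    {U : ℕ → UnitAddTorus d → EuclideanSpace ℝ d} {P : ℕ → UnitAddTorus d → ℝ} {E₀ M D ε : ℝ}
    (h : ∀ j, Torus.IsSteadyNSState (ν j) f (U j) (P j)) (hf : Torus.IsSmooth f)
    (hV : Torus.IsSmooth V) (hVd : Torus.IsDivFree V) (hν₀ : Tendsto ν atTop (𝓝 0))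
    (hE : ∀ j, ∫ x, ‖U j x‖ ^ 2 ≤ E₀)
    (h1 : Tendsto (fun j => ∫ x, ⟪f x, U j x - V x⟫_ℝ) atTop (𝓝 0))
    (h2 : Tendsto (fun j => ∫ x, ⟪Torus.convect V V x, U j x - V x⟫_ℝ) atTop (𝓝 0))
    (hM : ∀ x, Real.sqrt (∑ i, ‖Torus.partialDeriv i V x‖ ^ 2) ≤ M)
    (hD : ∀ j, ∫ x, ‖U j x - V x‖ ^ 2 ≤ D) (hε : ∀ j, ε ≤ ν j * Torus.gradNormSq (U j)) :
    ε ≤ M * D := by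
  obtain ⟨hdiss, -⟩ := anomaly_eq_production h hf hV hVd hν₀ hE h1 h2
  exact (ge_of_tendsto' hdiss hε).trans
    (dissipation_limit_le_strain_mul_defect h hf hV hVd hν₀ hE h1 h2 hM hD)

end Summit.AnomalousDissipation.AnomalousDissipation.Theorems

end
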